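import Summits.BirchSwinnertonDyer.BirchSwinnertonDyer.Theorems.KatoDescentTamePotSupersingularJetchevIrreducibleProp44SplitShell
import Summits.BirchSwinnertonDyer.BirchSwinnertonDyer.Theorems.Rank1ResidualJetDerivedPointReduction
import Summits.BirchSwinnertonDyer.BirchSwinnertonDyer.Theorems.Rank1ResidualJetKolyvaginReduction
import Summits.BirchSwinnertonDyer.BirchSwinnertonDyer.Theorems.Rank1ResidualJetKolyvaginDecompositionTrivial
import Literature.NumberTheory.EllipticCurves.ModularityVersionApProofs
import Literature.NumberTheory.EllipticCurves.SerreOpenImageOrdinaryInertiaProofs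
import HarnessLib

/-!
# Crux `JetchevIrreducibleReadingByName` (item 20165, shared K8-t′ / K9), stub S5 `stub_prop44Irred` — the
# (A)-conjunct `ord d_M(c)_λ = ord c_M(c)_λ` at a prime `ℓ ∣ c` PROVED for the tree's CONCRETE Kolyvagin classes
# (any image of `ρ̄`, Zhang–Kolyvagin currency), modulo only the class's standing inputs (admissibility, invariance)
# — seat `bsd-potss-k8t-c4` g10; `--supports 20165`, helper; route-free; nothing booked, no item closed, BSD is not
# proved by any of this

WHY. S5 = ∀ j, (A) `p^j c_M(mℓ) ∈ Sel_λ ↔ p^j c_M(mℓ) ∈ Ker_λ` ∧ (B) `p^j c_M(mℓ) ∈ Ker_λ ↔ p^j c_M(m) ∈ Ker_λ`. This file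
settles the (A)-conjunct as a THEOREM for the concrete classes `KolyvaginHeegnerData.kolyvaginClass` (the only
consumers of S5 use (B); (A) is what separates the registered split form from the tree's combined Prop. 4.4), by
assembling: this seat's abstract (A)-half `zsmul_kolyvaginClass_mem_torsionLocalKer_of_mem_selmerLocalKer_of_red`
(p527490); bsd-jet pv-2 g5's BRICKS B2 `JET.exists_kolyvaginReduction` (the reduction `E(K̄) → Ẽ(𝔽̄_ℓ)` at `𝔓 ∣ λ`:
inertia-invariant, Frobenius clause for every `g ≡ x^{ℓ^j}`, injective on prime-to-`ℓ` torsion) and B3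
`JET.exists_frobSq_forall_smul_emb_eq` (a Frobenius at `𝔓` FIXING `K[c]`) / `JET.exists_red_derivedPoint_eq_pow_smul`
(Howard 2.7.3: `red P(c) = p^k • b`, `φ² • b = b`); bsd-jet pv-1's Zhang-currency local facts
(`JET.GlobalDuality.hasGoodReductionAt_of_zhangKolyvaginPrime`, `…decompositionSubgroup_le_torsionFixing`); x11b3's
torsion lift `X11b.KolyvaginH44.exists_torsion_lift` (`E[n] ≃ Ẽ[n]`, `ℓ ∤ n`, for `φ²` fixing `Ẽ[p^M]`).

WHAT IS PROVED. `zsmul_kolyvaginClass_mem_torsionLocalKer_of_mem_selmerLocalKer` — for `K` imaginary quadratic,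
`E = W/ℚ` globally minimal, `p` odd, a square-free level `c` all of whose prime factors are Kolyvagin primes of
W. Zhang (`Zhang2014.IsKolyvaginPrime`), a prime `ℓ ∣ c` with `M ≤ M(ℓ)`, concrete data `d` at level `c` with the two
standing inputs of the class (`hA` admissibility = Gross Lemma 4.3 / McCallum (5); `hPt` invariance = Gross Prop. 3.6
with (4.1)), the place `λ ∋ ℓ` and any `k : ℤ`: **if `k · c_M(c)` satisfies the Selmer (Kummer) condition at `λ`, then
`k · c_M(c)` is locally TRIVIAL at `λ`**; and the `iff` form `…_iff_…` (McCallum's "`ord d_M(c)_λ = ord c_M(c)_λ`";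
Jetchev Prop. 4.7's `loc_λ κ_c ∈ H¹_tr`). No hypothesis on the image of `ρ̄`; no hypothesis on the reduction of `E`
at `p`. HONEST FRAMING: (B) — the Euler-system comparison with `c_M(c/ℓ)`, which rests on Gross Prop. 3.7 (2)
(Eichler–Shimura congruence, cite-only in x11b3's `h44_concrete_of_traceRelation_of_congruence`) — is NOT touched; S5,
the crux and BSD stay open; nothing asserted about any curve beyond the displayed hypotheses.

References: [cite: McCallumLMS1991, §4 Lemma 4.3, Prop. 4.4 (1)(3) "In particular" (p. 301), proof (p. 302)]
[cite: Jetchev2008, Prop. 4.7 (arXiv p. 11)] [cite: Howard2004HeegnerKolyvagin, Lemma 2.7.3]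
[cite: GrossLMS1991, §3 (3.5), Prop. 3.6, §4 (4.1), Prop. 9.6] [cite: SilvermanAEC2009, VII.3.1(b), VII.4.1, III.6.4(b)]
[cite: WZhang2014, Notations (xii)].
-/

set_option autoImplicit false
-- the Theorems directory repeats the summit name (sibling precedent `KatoDescentPotSupersingularAssembly.lean`)
set_option linter.dupNamespace false

noncomputable section

open scoped Classical Pointwise

open WeierstrassCurve NumberField IsDedekindDomain Field
  Literature.NumberTheory.GaloisRepresentations Literature.NumberTheory.EllipticCurves
  Literature.NumberTheory.EllipticCurves.KolyvaginCocycle Literature.NumberTheory.EllipticCurves.ModularForms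
  Summit.BirchSwinnertonDyer.Rank1Residual Summit.BirchSwinnertonDyer.Rank1Residual.X11b

namespace Summit.BirchSwinnertonDyer.BirchSwinnertonDyer.Theorems.JetchevIrreducibleProp44

-- `K : Type`: the tree's ring-class class field theory is universe `0`.
variable {K : Type} [Field K] [NumberField K]

/-- **McCallum Prop. 4.4 (1)+(3) — `ord d_M(c)_λ = ord c_M(c)_λ` — for the tree's CONCRETE Kolyvagin class at a prime
`ℓ ∣ c`** (any image of `ρ̄`; Zhang–Kolyvagin currency): if `k · c_M(c)` satisfies the Selmer condition at the place
`λ ∋ ℓ` then `k · c_M(c)` is locally trivial at `λ`. Assembly: the reduction `red` at `𝔓 ∣ λ` (bsd-jet B2), a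
Frobenius `F` at `𝔓` fixing `K[c]` (B3) — hence `F` fixes `P(c)` and `E[p^M]` (Zhang local facts), `red ∘ F = φ₀² ∘
red` —, `red P(c) ∈ p^M · Ẽ^{φ₀²}` (B3, Howard 2.7.3), `φ₀²` fixes `Ẽ[p^M]` (x11b3's torsion lift + `F` fixes
`E[p^M]`), and this seat's abstract (A)-half on McCallum's cocycle. CONDITIONAL only on the class's standing inputs
`hA`, `hPt` (displayed). [cite: McCallumLMS1991, Prop. 4.4 (1)(3) (p. 301)] [cite: Jetchev2008, Prop. 4.7]
[cite: Howard2004HeegnerKolyvagin, Lemma 2.7.3] [cite: GrossLMS1991, Prop. 9.6] -/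
theorem zsmul_kolyvaginClass_mem_torsionLocalKer_of_mem_selmerLocalKer (hK : IsImaginaryQuadratic K)
    (ι : K →+* ℂ) [∀ j : ℕ, NumberField (ringClassField K ι j)]
    (W : WeierstrassCurve ℚ) [W.IsElliptic] [W.IsGloballyMinimal] {N : ℕ} [NeZero N]
    {Dt : ModularParametrizationData W N} {β : ℤ}
    {p : ℕ} [Fact p.Prime] (hp2 : p ≠ 2) {M : ℕ}
    {c ℓ : ℕ} (hc : Squarefree c) (hℓc : ℓ ∈ c.primeFactors)
    (hKol : ∀ q ∈ c.primeFactors, Zhang2014.IsKolyvaginPrime (W.conductorNorm ℤ) W K p q)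
    (hMℓ : M ≤ Zhang2014.kolyvaginIndex W p ℓ)
    (d : KolyvaginHeegnerData Dt β ι c)
    (hA : IsAdmissible (absoluteGaloisGroup K) d.pointsSubgroup ((p ^ M : ℕ) : ℤ))
    (hPt : d.toGeomPoints d.derivedPoint ∈
      invPoints (absoluteGaloisGroup K) d.pointsSubgroup ((p ^ M : ℕ) : ℤ))
    (v : HeightOneSpectrum (𝓞 K)) (hv : (ℓ : 𝓞 K) ∈ v.asIdeal) (k : ℤ)
    (hsel : k • d.kolyvaginClass (Fact.out : p.Prime) M ∈
      selmerLocalKer (W.baseChange K) (v.adicCompletion K) ((p ^ M : ℕ) : ℤ)) :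
    k • d.kolyvaginClass (Fact.out : p.Prime) M ∈
      (W.baseChange K).torsionLocalKer (v.adicCompletion K) ((p ^ M : ℕ) : ℤ) := by
  have hp : p.Prime := Fact.out
  have hℓK := hKol ℓ hℓc
  have hℓ : ℓ.Prime := hℓK.1
  haveI : Fact ℓ.Prime := ⟨hℓ⟩
  have hℓN : ¬ ℓ ∣ W.conductorNorm ℤ := hℓK.2.1
  have hℓp : ℓ ≠ p := hℓK.2.2.2.1
  have hinertℓ : (Ideal.span {(ℓ : 𝓞 K)}).IsPrime := hℓK.2.2.2.2.1
  have hℓdvd : ℓ ∣ c := Nat.dvd_of_mem_primeFactors hℓc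
  -- `ℓ ∤ Δ_W` (good reduction at the Kolyvagin prime)
  have hgoodℓ : W.HasGoodReductionAtPrime ℓ := by
    by_contra h
    exact hℓN ((W.dvd_conductorNorm_iff_not_hasGoodReductionAtPrime ℓ).mpr h)
  have hΔ : ¬ (ℓ : ℤ) ∣ minimalDiscriminantInt W :=
    not_dvd_minimalDiscriminantInt_of_hasGoodReductionAtPrime' W ℓ hgoodℓ
  -- the place `λ = (ℓ)`: `v.asIdeal = (ℓ)`, unique over `ℓ`, residue field of order `ℓ²`
  have hne : Ideal.span {(ℓ : 𝓞 K)} ≠ ⊥ := by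
    rw [Ne, Ideal.span_singleton_eq_bot]; exact_mod_cast hℓ.ne_zero
  have hmax : (Ideal.span {(ℓ : 𝓞 K)}).IsMaximal := hinertℓ.isMaximal hne
  have hv' : v.asIdeal = Ideal.span {((ℓ : ℕ) : 𝓞 K)} :=
    (hmax.eq_of_le v.isPrime.ne_top ((Ideal.span_singleton_le_iff_mem _).mpr hv)).symm
  have huniq : ∀ w : HeightOneSpectrum (𝓞 K), (ℓ : 𝓞 K) ∈ w.asIdeal → w = v :=
    fun w hw ↦ JET.eq_of_natCast_mem_of_asIdeal_eq_span hv' w hw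
  have hinert : ∀ q ∈ c.primeFactors, (Ideal.span {(q : 𝓞 K)}).IsPrime := fun q hq ↦ (hKol q hq).2.2.2.2.1
  -- good reduction of `E/K` at `λ`, `λ ∤ p^M`
  obtain ⟨hgood, hnv⟩ := JET.GlobalDuality.hasGoodReductionAt_of_zhangKolyvaginPrime W K hℓK v hv M
  have hn0 : ((p ^ M : ℕ) : ℤ) ≠ 0 := by exact_mod_cast pow_ne_zero M hp.ne_zero
  have hq0 : p ^ M ≠ 0 := pow_ne_zero M hp.ne_zero
  have hℓpM : ¬ ℓ ∣ p ^ M := fun h ↦ hℓp ((Nat.prime_dvd_prime_iff_eq hℓ hp).mp (hℓ.dvd_of_dvd_pow h))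
  have hpMℓ : p ^ M ∣ ℓ + 1 := (Zhang2014.le_kolyvaginIndex_iff.mp hMℓ).1
  -- the local prime `𝔐` and the global prime `𝔓 ∣ λ` it cuts out
  set ι₀ := closureEmb (K := K) (v.adicCompletion K) with hι₀
  haveI : CharZero (v.adicCompletion K) :=
    charZero_of_injective_algebraMap (algebraMap K (v.adicCompletion K)).injective
  obtain ⟨𝔐, h𝔐⟩ := v.localPrimesAbove_nonempty
  have h𝔓 : v.primeBelow ι₀ 𝔐 ∈ v.primesAbove := HeightOneSpectrum.primeBelow_mem_primesAbove h𝔐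
  -- the `ℓ`-power Frobenius of `𝔽̄_ℓ`
  obtain ⟨φ₀, hφ₀'⟩ := exists_frobenius_absoluteGaloisGroup (ZMod ℓ)
  have hφ₀ : ∀ x : AlgebraicClosure (ZMod ℓ), φ₀ • x = x ^ ℓ := fun x ↦ by rw [hφ₀' x, Nat.card_zmod]
  -- BRICK B2: the reduction at `𝔓`
  obtain ⟨red, -, hredI, hredFrob, hredinj⟩ :=
    JET.exists_kolyvaginReduction (K := K) W hΔ hφ₀ hv huniq h𝔓
  -- BRICK B3: a Frobenius at `𝔓` fixing `K[c]`
  let e : ringClassField K ι c →ₐ[K] AlgebraicClosure K := { d.emb with commutes' := d.emb_apply }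
  have he : ∀ x, e x = d.emb x := fun _ ↦ rfl
  obtain ⟨F, hFz, hFe⟩ := JET.exists_frobSq_forall_smul_emb_eq hK ι hc hℓ hℓdvd hinertℓ hv' h𝔓 e
  have hF : IsArithFrobAt (𝓞 K) F (v.primeBelow ι₀ 𝔐) := by
    rw [HeightOneSpectrum.isArithFrobAt_iff_of_mem_primesAbove h𝔓,
      JET.residueCard_eq_sq_of_asIdeal_eq_span hK hℓ hinertℓ hv']
    exact hFz
  haveI := h𝔓.1
  have hFfix : F ∈ torsionFixing (W.baseChange K) ((p ^ M : ℕ) : ℤ) :=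
    JET.GlobalDuality.decompositionSubgroup_le_torsionFixing W K hK hℓK hMℓ v hv h𝔓 hF.mem_stabilizer
  have hFP : F • d.toGeomPoints d.derivedPoint = d.toGeomPoints d.derivedPoint :=
    JET.smul_toGeomPoints_eq_self_of_forall_smul_emb d (fun x ↦ by rw [← he]; exact hFe x) _
  -- the reduction Frobenius `φ = φ₀²` matching `F`
  set φ : (reductionModPrime W ℓ).geomPoints →+ (reductionModPrime W ℓ).geomPoints :=
    DistribSMul.toAddMonoidHom _ (φ₀ ^ 2) with hφdef
  have hφ : ∀ b, φ b = (φ₀ ^ 2) • b := fun _ ↦ rfl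
  have hredF : ∀ x, red (F • x) = φ (red x) := fun x ↦ by rw [hφ]; exact hredFrob F 2 hFz x
  have hred : ∀ x : geomPoints (W.baseChange K), ((p ^ M : ℕ) : ℤ) • x = 0 → red x = 0 → x = 0 :=
    hredinj (p ^ M) hℓpM
  -- `φ₀²` fixes `Ẽ[p^M]`: lift along `red` (x11b3) and use that `F` fixes `E[p^M]`
  have hBn : ∀ b : (reductionModPrime W ℓ).geomPoints, ((p ^ M : ℕ) : ℤ) • b = 0 → φ b = b := by
    intro b hb
    set θ := RatClosure.pointsEquiv (K := K) W with hθ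
    have hinj' : ∀ m : ℕ, ¬ ℓ ∣ m → ∀ P : W.geomPoints, m • P = 0 →
        (red.comp θ.toAddMonoidHom) P = 0 → P = 0 := by
      intro m hm P hmP hP0
      have h1 : ((m : ℤ)) • θ P = 0 := by
        rw [natCast_zsmul, ← map_nsmul, hmP, map_zero]
      have h2 : θ P = 0 := hredinj m hm (θ P) h1 hP0
      exact (map_eq_zero_iff θ θ.injective).mp h2
    obtain ⟨P, hPn, hPb⟩ := KolyvaginH44.exists_torsion_lift W hΔ hinj' hℓpM hq0 b hb
    have hxn : θ P ∈ geomTorsion (W.baseChange K) ((p ^ M : ℕ) : ℤ) := by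
      rw [mem_torsionBy_iff, ← map_zsmul, hPn, map_zero]
    have hFx : F • θ P = θ P := by
      have h := (mem_torsionFixing_iff _ _).mp hFfix ⟨θ P, hxn⟩
      exact congrArg Subtype.val h
    change (red.comp θ.toAddMonoidHom) P = b at hPb
    change red (θ P) = b at hPb
    rw [← hPb, ← hredF, hFx]
  -- BRICK B3: `red P(c) = p^M • b₀` with `φ₀² • b₀ = b₀`
  obtain ⟨b₀, hb₀, hφb₀⟩ := JET.exists_red_derivedPoint_eq_pow_smul hK ι hc hℓ hℓdvd hinert hp hp2 hpMℓ hv'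
    h𝔓 d φ₀ red hredI (fun g hg x ↦ hredFrob g 2 hg x)
  have hPred : ∃ b, φ b = b ∧ red (d.toGeomPoints d.derivedPoint) = ((p ^ M : ℕ) : ℤ) • b :=
    ⟨b₀, by rw [hφ]; exact hφb₀, by rw [natCast_zsmul]; exact hb₀⟩
  -- the class is McCallum's class of `P(c)`; apply the abstract (A)-half
  rw [d.kolyvaginClass_of_admissible hp M hA hPt] at hsel ⊢
  exact zsmul_kolyvaginClass_mem_torsionLocalKer_of_mem_selmerLocalKer_of_red (W.baseChange K) hA hPt hgood
    hnv hn0 h𝔐 hF hFfix (torsionPointsMap_bijective (W.baseChange K) (v.adicCompletion K) hq0).2 hFP red φ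
    hredF hred hBn hPred k hsel

/-- **`ord d_M(c)_λ = ord c_M(c)_λ` for the concrete class, as an equivalence** (the converse is
`torsionLocalKer_le_selmerLocalKer`). [cite: McCallumLMS1991, Prop. 4.4 "In particular" (p. 301)] -/
theorem zsmul_kolyvaginClass_mem_selmerLocalKer_iff_mem_torsionLocalKer (hK : IsImaginaryQuadratic K)
    (ι : K →+* ℂ) [∀ j : ℕ, NumberField (ringClassField K ι j)]
    (W : WeierstrassCurve ℚ) [W.IsElliptic] [W.IsGloballyMinimal] {N : ℕ} [NeZero N]
    {Dt : ModularParametrizationData W N} {β : ℤ}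
    {p : ℕ} [Fact p.Prime] (hp2 : p ≠ 2) {M : ℕ}
    {c ℓ : ℕ} (hc : Squarefree c) (hℓc : ℓ ∈ c.primeFactors)
    (hKol : ∀ q ∈ c.primeFactors, Zhang2014.IsKolyvaginPrime (W.conductorNorm ℤ) W K p q)
    (hMℓ : M ≤ Zhang2014.kolyvaginIndex W p ℓ)
    (d : KolyvaginHeegnerData Dt β ι c)
    (hA : IsAdmissible (absoluteGaloisGroup K) d.pointsSubgroup ((p ^ M : ℕ) : ℤ))
    (hPt : d.toGeomPoints d.derivedPoint ∈
      invPoints (absoluteGaloisGroup K) d.pointsSubgroup ((p ^ M : ℕ) : ℤ))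
    (v : HeightOneSpectrum (𝓞 K)) (hv : (ℓ : 𝓞 K) ∈ v.asIdeal) (k : ℤ) :
    k • d.kolyvaginClass (Fact.out : p.Prime) M ∈
        selmerLocalKer (W.baseChange K) (v.adicCompletion K) ((p ^ M : ℕ) : ℤ) ↔
      k • d.kolyvaginClass (Fact.out : p.Prime) M ∈
        (W.baseChange K).torsionLocalKer (v.adicCompletion K) ((p ^ M : ℕ) : ℤ) :=
  ⟨zsmul_kolyvaginClass_mem_torsionLocalKer_of_mem_selmerLocalKer hK ι W hp2 hc hℓc hKol hMℓ d hA hPt v hv k,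
    fun h ↦ (W.baseChange K).torsionLocalKer_le_selmerLocalKer (v.adicCompletion K) _ h⟩

end Summit.BirchSwinnertonDyer.BirchSwinnertonDyer.Theorems.JetchevIrreducibleProp44

end
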